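import Summits.QuantumFields.YangMills.Theorems.BackwardLiouvilleRigidityOneStepBackwardContractionAdmDescentDisintegration
import HarnessLib

/-!
R-CUT-χ (2026-08-30 ≈19:3xZ, g26; LEAD w3 g23 WORD №1 (iii) «R-CUT-χ», ideator №3 GO): the `sfCut` numerals (½, ¾) ↦ (½, 24∕25) —
`sfCut θ U = ∏ p, max 0 (min 1 ((24/25·θ − dist1 (plaqHol U p)) / ((24/25 − 1/2)·θ)))`: `= 1` iff every `dist1 ≤ θ/2` (unchanged), `= 0` iff some
`dist1 ≥ (24/25)θ`, `{sfCut > 0} = {PlaqSmall ((24/25)θ)}` — so that the one-step spread lifts the fibre-mean rows need exist for EVERY odd block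
size `L ≥ 3` from LANDED kernels (gain `0.9482·` at `L = 3` < 24/25; LEAD (M3) letter).  Every row ∕ junction text not naming the constant is
byte-identical to the previous version.

# LINE g25-3 «version_coarea» v1.4 — VER∘ (`FibreMeanVersionCan` v2.4 = v2.3's body over O1 v17's frame, row 1 of LINE g25-1 «organ_tangent») cut into
# PURE GEOMETRY OF THE AVERAGING MAP (COAREA∘) + a compactness pinch (PINCH∘)
# (crux stmt-QuantumFields-20520 `FluctuationComparisonRegPrIntL`; package `runpair_organ` v17 = R-c + R-a + R-n4 ⟸ … ⟸ O1 ⟸ VER∘ ∧ LIN∘ ∧ JEN∘)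

v1.3 (≈18:3xZ): frame = O1 v17.1's (SMOOTH tower cut; (R1)); COAREA∘ identical; PINCH∘∕VER∘ bodies byte-identical to v1.2∕v1.1.

v1.2 (2026-08-30, g25; ★★OWNER g37 №139 ∕ RULING №54, LEAD w3 g22; D25-8; critic g14 #527∕#531 Q1): VER∘ and PINCH∘ RE-COPIED BY SCRIPT over
O1 v17's FRAME (anchored, SF-projected below the seed, sub-probability, membership modulo constants); COAREA∘ is tower-free and
BYTE-IDENTICAL to v1.1; PINCH∘'s body byte-identical (w5 g21's ✓p781960 `fibrePinch` discharged the v1.1 text — the re-lift to the v1.2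
frame is mechanical: only window positivity ∕ continuity of the frame are used).  Pre-v17 PINCH∘∕VER∘ were provable by emptiness (Q1).

bears_on: R3:stmt-QuantumFields-20520 [ym-r3-idea-1-g25] · LENS «control» (the controlling object here is the REGULAR FIBRE PACKAGE
`λ_V` of Bałaban's block averaging: an un-normalised co-area measure on the small-field part of each fibre, continuous in the datum).

HONESTY.  Nothing of Bałaban's is asserted here; every row is a `def … : Prop`, both `stub_*` are `sorry`s, and the only kernel-checked
content is the ★ junction `fibreMeanVersion_of_coarea` (and the plug `fibreMeanVersion_of_stubs`).  VER∘, O1, item 20520 and the rung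
leaf `…T3YM3TorusStatement.YM3TorusSU2` are NOT proved.  R3 = SU(2) YM₃ on T³ — NOT d = 4, NOT infinite volume, NOT a mass gap, NOT
Clay.  No summit is proved by a line.

THE CUT.  VER∘ (restated verbatim below as `FibreMeanVersionCan`, byte-identical with `OrganTangent.FibreMeanVersionCan` v2.3 of
`Lines/organ_tangent.lean`; docked there by text identity, never imported) asks, in Bałaban's parameter regime and from a height `jV`
on, for a window-continuous version `m` of the LOCALISED fibre mean `E′_χ[h | V] = (∫ χhρ′ dσ_V)/(∫ χρ′ dσ_V)` of the fine discrepancy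
`h = log ρ_{j+1} − log ρ′_{j+1}`, `χ = sfCut θ_{j+1}`, for EVERY disintegration kernel `σ` of fine Haar along `descend` and every tower of
the frame.  Observation: the towers enter only through the two integrands `g₁ = χhρ′`, `g₂ = χρ′`, which are CONTINUOUS functions on
the (compact) fine field space vanishing where `χ = 0`, with `g₂ ≥ 0` and `g₂ > 0` on `{PlaqSmall (24∕25)θ_{j+1}}` — that is PINCH∘, a
compactness exercise over the frame (the frame makes `ρ, ρ′` continuous and positive on the OPEN fine window, which contains the COMPACT
support `{∀ p, dist1 ≤ (24∕25)θ_{j+1}}` of `χ`).  Everything else is a statement about HAAR MEASURE AND THE AVERAGING MAP ALONE — COAREA∘: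
from a height `jV(F, γ, b₀, p₀)` on there is a package `V ↦ λ_V` of finite measures on the fine field space (intended: the co-area ∕
Leray fibre measure `J⁻¹ dH^{fibre}` of `descend` restricted to its regular region, which contains `{χ > 0}` once `θ_{j+1}L²` is small)
such that (INT) continuous functions are `λ_V`-integrable, (CONT) `V ↦ ∫ g dλ_V` is continuous on the coarse window for continuous `g`
killed by `χ = 0` (Ehresmann: a submersion is a locally trivial fibration near a compact regular set), (MASS) `λ_V{PlaqSmall (24∕25)θ_{j+1}} > 0`
for every window datum `V` (a SPREAD LIFT: every coarse field with defects `< θ_j` is the average of a fine field with defects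
`< (24∕25)θ_{j+1}`, at which `descend` is submersive — `C_lift·θ_j/L² < (24∕25)θ_{j+1}`), and (DISINT) for every kernel `σ` of the D-organ there is
`φ > 0` a.e. on the window with `∫ g dσ_V = φ(V)⁻¹ ∫ g dλ_V` for such `g` (disintegration uniqueness + `descend_* Haar ~ Haar` on the
window, `φ` = the co-area density of `descend_* Haar`).  The ★ junction then DEFINES `m(V) := (∫ g₁ dλ_V)/(∫ g₂ dλ_V)`: continuity on the
window is `ContinuousOn.div` (denominator `> 0` by MASS, `integral_pos_iff_support_of_nonneg`), and a.e. on the window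
`m(V) = (φ⁻¹∫g₁dλ_V)/(φ⁻¹∫g₂dλ_V) = E′_χ[h | V]` (`mul_div_mul_left`).  So VER∘'s three declared risks (regularity of the averaging map
on the cut-off region, positive `χ`-mass of window fibres, `ν ~ Haar`) now sit in ONE tower-free row that an instrument or a geometer can
attack directly, and the class ∕ tower bookkeeping is gone from it.

WHY THIS LINE (D-0145 skeleton; LENS «control»).  (i) It de-risks the must-fix row of idea-crit-5 #514∕#522 (VER∘) for the LEAD and for
w4's T-LIFT: COAREA∘ is decidable mathematics about a concrete polynomial map between compact Lie-group powers (Bałaban's average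
[Balaban1985Averaging] (10)–(13)), independent of every renormalisation-group claim; (ii) its cheapest falsifier is numerical and
small (MASS at `L = 3`: the spread-lift constant against `(24∕25)L^{3/2} = 4.99`; R-CUT-χ: at the old `¾` top L = 3 was an open minimax, LEAD w3 g23 (M3) letter); (iii) KT-W and B-8(a) are moot here (no tower is transported;
the frame is only read at height `j+1 ≤ T` by PINCH∘).

Rows restated BY TEXT (never imported): `sfCut` (v2.1 body) and VER∘ `FibreMeanVersionCan` (v2.3 body) from `Lines/organ_tangent.lean`.
Landed organs used BY NAME: none in the junction (the D-organ `FibreLaplace.stub_descentDisintegration` is what makes VER∘'s `∀ σ`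
non-vacuous; cited, not used).
-/

open MeasureTheory Filter Topology
open Literature.MathematicalPhysics.QuantumFieldTheory.Balaban1983to89 T3ContinuumYM3Torus T3NestedUnitLaws
  T3UnitLawDensityEML T4Continuum BalabanUVClass T3UnitScaleTilt

namespace Summit.QuantumFields.YangMills.Cruxes.FluctuationComparisonRegPrIntL.VersionCoarea

noncomputable def sfCut {P : Params} {k : ℕ} (θ : ℝ) (U : GaugeField P k ↥(Matrix.specialUnitaryGroup (Fin 2) ℂ)) : ℝ :=
  ∏ p : Plaq P k, max 0 (min 1 ((24 / 25 * θ - dist1 (GaugeField.plaqHol U p)) / ((24 / 25 - 1 / 2) * θ)))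


/-- VER∘ · `FibreMeanVersionCan` — restated BY TEXT, byte-identical with `OrganTangent.FibreMeanVersionCan` v2.3
(`Lines/organ_tangent.lean`; the row this line serves).  In Bałaban's parameter regime and from a height `jV` on, a window-continuous
version `m` of the localised fibre mean `E′_χ[h | V]` exists, for every kernel `σ` of the D-organ and every tower of O1's frame. -/
def FibreMeanVersionCan : Prop :=
  ∀ (F : T3Family) (γ b₀ p₀ : ℝ), 0 < γ → γ ≤ 1 → 0 < b₀ → 0 < p₀ → ∃ jV : ℕ, ∀ (j₀ : ℕ) (prm : ℕ → ClassParams) (η : ℕ → ℝ), ∀ (ν : ℕ → (j : ℕ) → MeasureTheory.Measure (GaugeField (F.P j) 0 ↥(Matrix.specialUnitaryGroup (Fin 2) ℂ))), (∀ K, ν K K = T4GenFunBounds.gibbsMeasure (F.P K) ((F.scheme ℰp γ).β K)) → (∀ K j, j < K → ν K j = Measure.map (descend F ℰp j) (ν K (j + 1))) → ∀ (K K' : ℕ), K ≤ K' → ∀ (Ts T : ℕ), Ts < T → T ≤ K → ∀ (μ μ' : ((j : ℕ) → MeasureTheory.Measure (GaugeField (F.P j) 0 ↥(Matrix.specialUnitaryGroup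 (Fin 2) ℂ)))) (ρ ρ' : ((j : ℕ) → GaugeField (F.P j) 0 ↥(Matrix.specialUnitaryGroup (Fin 2) ℂ) → ℝ)), (∀ j : ℕ, Ts ≤ j → j ≤ T → μ j = ν K j ∧ μ' j = ν K' j) → (∀ j : ℕ, j < Ts → μ j = Measure.map (descend F ℰp j) ((μ (j + 1)).withDensity (fun U => ENNReal.ofReal (sfCut (θBal F.L γ b₀ p₀ (j + 1)) U))) ∧ μ' j = Measure.map (descend F ℰp j) ((μ' (j + 1)).withDensity (fun U => ENNReal.ofReal (sfCut (θBal F.L γ b₀ p₀ (j + 1)) U)))) → (∀ j : ℕ, Ts ≤ j → j < T → μ j = Measure.map (descend F ℰp j) (μ (j + 1)) ∧ μ' j = Measure.map (descend F ℰp j) (μ' (j + 1))) → (∀ j : ℕ, j ≤ T → IsFiniteMeasure (μ j) ∧ IsFiniteMeasure (μ' j)) → (∀ j : ℕ, j₀ ≤ j → j ≤ T → ((∀ U, PlaqSmall (θBal F.L γ b₀ p₀ j) U → 0 < ρ j U ∧ 0 < ρ' j U) ∧ μ j = (fieldMeasure _ _ _).withDensity (fun U => ENNReal.ofReal (ρ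 j U)) ∧ μ' j = (fieldMeasure _ _ _).withDensity (fun U => ENNReal.ofReal (ρ' j U)) ∧ (∃ κ : ℝ, MemAtHeight F ℰp j (prm j) (fun U => Real.exp κ * ρ j U)) ∧ (∃ κ : ℝ, MemAtHeight F ℰp j (prm j) (fun U => Real.exp κ * ρ' j U)) ∧ μ j {U | ¬ PlaqSmall (θBal F.L γ b₀ p₀ j) U} ≤ ENNReal.ofReal (η j) ∧ μ' j {U | ¬ PlaqSmall (θBal F.L γ b₀ p₀ j) U} ≤ ENNReal.ofReal (η j) ∧ (ContinuousOn (ρ j) {U | PlaqSmall (θBal F.L γ b₀ p₀ j) U} ∧ ContinuousOn (ρ' j) {U | PlaqSmall (θBal F.L γ b₀ p₀ j) U}))) → ∀ (j : ℕ), jV ≤ j → j₀ ≤ j → j + 1 ≤ T → ∀ (σ : ProbabilityTheory.Kernel (GaugeField (F.P j) 0 ↥(Matrix.specialUnitaryGroup (Fin 2) ℂ)) (GaugeField (F.P (j + 1)) 0 ↥(Matrix.specialUnitaryGroup (Fin 2) ℂ))), ProbabilityTheory.IsMarkovKernel σ → (Measure.map (descend F ℰp j) (fieldMeasure (F.P (j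 + 1)) 0 ↥(Matrix.specialUnitaryGroup (Fin 2) ℂ))).bind ⇑σ = fieldMeasure (F.P (j + 1)) 0 ↥(Matrix.specialUnitaryGroup (Fin 2) ℂ) → (∀ᵐ V ∂(Measure.map (descend F ℰp j) (fieldMeasure (F.P (j + 1)) 0 ↥(Matrix.specialUnitaryGroup (Fin 2) ℂ))), ∀ᵐ U ∂(σ V), descend F ℰp j U = V) → ∃ (m : GaugeField (F.P j) 0 ↥(Matrix.specialUnitaryGroup (Fin 2) ℂ) → ℝ), ContinuousOn m {V | PlaqSmall (θBal F.L γ b₀ p₀ j) V} ∧ (∀ᵐ V ∂(fieldMeasure (F.P j) 0 ↥(Matrix.specialUnitaryGroup (Fin 2) ℂ)), PlaqSmall (θBal F.L γ b₀ p₀ j) V → MeasureTheory.Integrable (fun U => sfCut (θBal F.L γ b₀ p₀ (j + 1)) U * (Real.log (ρ (j + 1) U) - Real.log (ρ' (j + 1) U)) * ρ' (j + 1) U) (σ V) ∧ m V = (∫ U, sfCut (θBal F.L γ b₀ p₀ (j + 1)) U * (Real.log (ρ (j + 1) U) - Real.log (ρ' (j + 1) U)) * ρ' (j + 1) U ∂(σ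 V)) / (∫ U, sfCut (θBal F.L γ b₀ p₀ (j + 1)) U * ρ' (j + 1) U ∂(σ V)))

/-- COAREA∘ · REGULAR FIBRE PACKAGE of the averaging map (row 1, the CONTENT; size M–L — differential topology of Bałaban's block
average + co-area, no renormalisation group).  In the regime `0 < γ ≤ 1`, `0 < b₀`, `0 < p₀`, from a height `jV(F, γ, b₀, p₀)` on, there is
`λ : T_j → Measure T_{j+1}` with: (INT) every continuous `g` is `λ_V`-integrable; (CONT) for continuous `g` vanishing where
`sfCut θ_{j+1} = 0`, `V ↦ ∫ g dλ_V` is continuous on the coarse window `{PlaqSmall θ_j}`; (MASS) `0 < λ_V {PlaqSmall (24∕25)θ_{j+1}}` for every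
window datum `V`; (DISINT) for every Markov kernel `σ` disintegrating fine Haar along `descend` there is `φ : T_j → ℝ`, `φ > 0` a.e. on
the window, with `g` `σ_V`-integrable and `∫ g dσ_V = φ(V)⁻¹ · ∫ g dλ_V` for all such `g`, for Haar-a.e. window `V`.  Intended witness:
`λ_V := 1_R · J_{descend}⁻¹ · dH^{descend⁻¹(V)}` (Leray ∕ co-area fibre measure on the regular region `R` of `descend`), `φ` := the
density of `descend_* Haar` w.r.t. coarse Haar.
Why it might fail: (1) MASS is a SPREAD-LIFT inequality — every coarse field with all defects `< θ_j` must be the average of a fine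
field with all defects `< (24∕25)θ_{j+1}` at which `descend` is submersive; with `θ_{j+1}/θ_j → L^{−1/2}` this needs a lift constant
`C_lift < (24∕25)L^{3/2}` (`= 4.99` at `L = 3`; gain `κ√L < 24∕25`, reached by the LANDED `CertL3Tree` kernel `0.9482` and ANSATZ S∕T for L ≥ 5), uniformly in `j` — unmeasured; (2) CONT needs `descend` to be a submersion on a neighbourhood
of `{sfCut θ_{j+1} > 0} ∩ descend⁻¹(window)` — granted only where the averaged transporters are mutually close (`θ_{j+1}L²` small, hence
`∃ jV`), and the projection to `SU(2)` of the block sum must stay away from its singular set there; (3) DISINT needs `descend_* Haar`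
and coarse Haar to be mutually absolutely continuous on the window (else `σ_V` is unconstrained on a Haar-positive window set) — true
iff Haar-a.e. fine field is a regular point AND every window datum has regular lifts.
(3♯ — critic #526 P1, the sharp form of (3); v1.1, docstring only.)  DISINT as typed quantifies `∀ᵐ V ∂ fieldMeasure_j` on the window
while `σ` is pinned only `descend_* Haar_{j+1}`-a.e.; hence COAREA∘ ⟹ SUBM∘ := `(fieldMeasure_j)|window_j ≪ descend_* Haar_{j+1}` (on a
Haar-positive, `descend_* Haar`-null window set `σ` could be two different Diracs in `{χ > 0}` — both Markov, both with the bind and fibre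
clauses — forcing `λ_V ∝ δ_{U₀}` and `∝ δ_{U₁}` on the test class: contradiction).  What decides SUBM∘ (tree): `descend = fieldShift ∘ avgFun ℰ`,
`avgFun U c = corr ℰ U c * axialAvg U c` (BlockAveraging l.798); `axialAvg` is a bond product (submersive, onto); `corr` applies
`expMeanLogSU`, which is the printed exp-mean-log ONLY on the guard `‖W_i − 1‖ < deltaSU (Fin 2) = min (1/3) (π/2) = 1/3`
(BlockAveragingExpMeanLog l.654) and the constant `1` off it — so `descend` is analytic ∕ submersive exactly where all block-loop holonomies
sit inside the guard, and piecewise-constant-in-`corr` elsewhere (a jump inside `supp g` would be fatal for CONT).  On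
`supp χ = {∀ p, dist1 ≤ (24∕25)θ_{j+1}}` the guard holds as soon as `(24∕25)θ_{j+1} ≤ deltaSU (Fin 2) / ((d + 4)L)²` — the small-field hypothesis
`2α₀ ≤ 2δ_N/((d + 4)L)²` of the tree's Prop. 2 `plaqSmall_iter_blockAvg_eml` (BlockAveragingEMLProp2 l.1235 ff.; `= 1/1323` at `d = 3`,
`L = 3`).  THIS is the defining inequality of `jV`: the least `j ≥ j₁` from which it holds (it exists: `θBal (j+1) → 0` for `γ ≤ 1`);
below `jV` the row makes no claim (VER∘ v2.3 agrees), and the same constant feeds w4's T-LIFT.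
Sources: [Balaban1985Averaging] (10)–(13), (19) (the averaging map, its minimisers); [Balaban1985UV3] (42)–(44) p.266–267 (regular
minimiser of window data); Federer ∕ Evans–Gariepy §3.4 (co-area formula) [corpus:book:evansnd-measure-theory-fine-properties-functions-revised-edition p.67, p.84];
Ehresmann's fibration lemma (proper submersions are locally trivial). -/
def RegularFibrePackageCan : Prop :=
  ∀ (F : T3Family) (γ b₀ p₀ : ℝ), 0 < γ → γ ≤ 1 → 0 < b₀ → 0 < p₀ → ∃ jV : ℕ, ∀ (j : ℕ), jV ≤ j → ∃ (lam : GaugeField (F.P j) 0 ↥(Matrix.specialUnitaryGroup (Fin 2) ℂ) → MeasureTheory.Measure (GaugeField (F.P (j + 1)) 0 ↥(Matrix.specialUnitaryGroup (Fin 2) ℂ))), (∀ (V : GaugeField (F.P j) 0 ↥(Matrix.specialUnitaryGroup (Fin 2) ℂ)) (g : GaugeField (F.P (j + 1)) 0 ↥(Matrix.specialUnitaryGroup (Fin 2) ℂ) → ℝ), Continuous g → MeasureTheory.Integrable g (lam V)) ∧ (∀ (g : GaugeField (F.P (j + 1)) 0 ↥(Matrix.specialUnitaryGroup (Fin 2)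 ℂ) → ℝ), Continuous g → (∀ U, sfCut (θBal F.L γ b₀ p₀ (j + 1)) U = 0 → g U = 0) → ContinuousOn (fun V => ∫ U, g U ∂(lam V)) {V | PlaqSmall (θBal F.L γ b₀ p₀ j) V}) ∧ (∀ (V : GaugeField (F.P j) 0 ↥(Matrix.specialUnitaryGroup (Fin 2) ℂ)), PlaqSmall (θBal F.L γ b₀ p₀ j) V → 0 < lam V {U | PlaqSmall (24 / 25 * θBal F.L γ b₀ p₀ (j + 1)) U}) ∧ (∀ (σ : ProbabilityTheory.Kernel (GaugeField (F.P j) 0 ↥(Matrix.specialUnitaryGroup (Fin 2) ℂ)) (GaugeField (F.P (j + 1)) 0 ↥(Matrix.specialUnitaryGroup (Fin 2) ℂ))), ProbabilityTheory.IsMarkovKernel σ → (Measure.map (descend F ℰp j) (fieldMeasure (F.P (j + 1)) 0 ↥(Matrix.specialUnitaryGroup (Fin 2) ℂ))).bind ⇑σ = fieldMeasure (F.P (j + 1)) 0 ↥(Matrix.specialUnitaryGroup (Fin 2) ℂ) → (∀ᵐ V ∂(Measure.map (descend F ℰp j) (fieldMeasure (F.P (j + 1)) 0 ↥(Matrix.specialUnitaryGroup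 (Fin 2) ℂ))), ∀ᵐ U ∂(σ V), descend F ℰp j U = V) → ∃ (φ : GaugeField (F.P j) 0 ↥(Matrix.specialUnitaryGroup (Fin 2) ℂ) → ℝ), ∀ᵐ V ∂(fieldMeasure (F.P j) 0 ↥(Matrix.specialUnitaryGroup (Fin 2) ℂ)), PlaqSmall (θBal F.L γ b₀ p₀ j) V → 0 < φ V ∧ ∀ (g : GaugeField (F.P (j + 1)) 0 ↥(Matrix.specialUnitaryGroup (Fin 2) ℂ) → ℝ), Continuous g → (∀ U, sfCut (θBal F.L γ b₀ p₀ (j + 1)) U = 0 → g U = 0) → MeasureTheory.Integrable g (σ V) ∧ ∫ U, g U ∂(σ V) = (φ V)⁻¹ * ∫ U, g U ∂(lam V))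

/-- PINCH∘ · COMPACTNESS PINCH over the frame (row 2, ROUTINE; size S–M — point-set topology on the compact fine field space).  In the
regime `0 < γ ≤ 1`, `0 < b₀`, `0 < p₀` (so `θ_{j+1} > 0`, tree `T3MinimiserStabilityReduction.θBal_pos`) and under O1's tower block at a
height `j` with `j₀ ≤ j`, `j + 1 ≤ T`: the two integrands of the localised fibre mean, `g₁ = χ·(log ρ_{j+1} − log ρ′_{j+1})·ρ′_{j+1}` and
`g₂ = χ·ρ′_{j+1}` (`χ = sfCut θ_{j+1}`), are CONTINUOUS on the whole fine field space (`χ` is continuous — `dist1 ∘ plaqHol` is, tree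
`N07DirectMethod.continuous_dist1_plaqHol` — and vanishes on the open complement of the compact set `K = {∀ p, dist1 ≤ (24∕25)θ_{j+1}}`, while
`K` lies inside the OPEN fine window `{PlaqSmall θ_{j+1}}` on which the frame makes `ρ_{j+1}, ρ′_{j+1}` continuous and positive, so
`log` is continuous there), `g₂ ≥ 0` everywhere, and `g₂ > 0` on `{PlaqSmall (24∕25)θ_{j+1}}` (each factor of `χ` is `> 0` iff `dist1 < (24∕25)θ`).
Why it might fail: it should not — it is the routine half of the cut, kept as a registered stub so that the junction is honest about
what it uses (instances: `T3OrbitAverage.instCompactSpaceGaugeField`, `instBorelSpaceGaugeField`, scoped).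
Sources: Mathlib `ContinuousOn`, `IsCompact.exists_isMinOn`; tree `continuous_dist1_plaqHol`, `θBal_pos`. -/
def FibrePinchCan : Prop :=
  ∀ (F : T3Family) (γ b₀ p₀ : ℝ), 0 < γ → γ ≤ 1 → 0 < b₀ → 0 < p₀ → ∀ (j₀ : ℕ) (prm : ℕ → ClassParams) (η : ℕ → ℝ), ∀ (ν : ℕ → (j : ℕ) → MeasureTheory.Measure (GaugeField (F.P j) 0 ↥(Matrix.specialUnitaryGroup (Fin 2) ℂ))), (∀ K, ν K K = T4GenFunBounds.gibbsMeasure (F.P K) ((F.scheme ℰp γ).β K)) → (∀ K j, j < K → ν K j = Measure.map (descend F ℰp j) (ν K (j + 1))) → ∀ (K K' : ℕ), K ≤ K' → ∀ (Ts T : ℕ), Ts < T → T ≤ K → ∀ (μ μ' : ((j : ℕ) → MeasureTheory.Measure (GaugeField (F.P j) 0 ↥(Matrix.specialUnitaryGroup (Fin 2) ℂ)))) (ρ ρ' : ((j : ℕ) → GaugeField (F.P j) 0 ↥(Matrix.specialUnitaryGroup (Fin 2) ℂ) → ℝ)), (∀ j : ℕ, Ts ≤ j → j ≤ T → μ j =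 ν K j ∧ μ' j = ν K' j) → (∀ j : ℕ, j < Ts → μ j = Measure.map (descend F ℰp j) ((μ (j + 1)).withDensity (fun U => ENNReal.ofReal (sfCut (θBal F.L γ b₀ p₀ (j + 1)) U))) ∧ μ' j = Measure.map (descend F ℰp j) ((μ' (j + 1)).withDensity (fun U => ENNReal.ofReal (sfCut (θBal F.L γ b₀ p₀ (j + 1)) U)))) → (∀ j : ℕ, Ts ≤ j → j < T → μ j = Measure.map (descend F ℰp j) (μ (j + 1)) ∧ μ' j = Measure.map (descend F ℰp j) (μ' (j + 1))) → (∀ j : ℕ, j ≤ T → IsFiniteMeasure (μ j) ∧ IsFiniteMeasure (μ' j)) → (∀ j : ℕ, j₀ ≤ j → j ≤ T → ((∀ U, PlaqSmall (θBal F.L γ b₀ p₀ j) U → 0 < ρ j U ∧ 0 < ρ' j U) ∧ μ j = (fieldMeasure _ _ _).withDensity (fun U => ENNReal.ofReal (ρ j U)) ∧ μ' j = (fieldMeasure _ _ _).withDensity (fun U => ENNReal.ofReal (ρ' j U)) ∧ (∃ κ : ℝ, MemAtHeight F ℰp j (prm j) (fun U => Real.exp κ * ρ j U)) ∧ (∃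 κ : ℝ, MemAtHeight F ℰp j (prm j) (fun U => Real.exp κ * ρ' j U)) ∧ μ j {U | ¬ PlaqSmall (θBal F.L γ b₀ p₀ j) U} ≤ ENNReal.ofReal (η j) ∧ μ' j {U | ¬ PlaqSmall (θBal F.L γ b₀ p₀ j) U} ≤ ENNReal.ofReal (η j) ∧ (ContinuousOn (ρ j) {U | PlaqSmall (θBal F.L γ b₀ p₀ j) U} ∧ ContinuousOn (ρ' j) {U | PlaqSmall (θBal F.L γ b₀ p₀ j) U}))) → ∀ (j : ℕ), j₀ ≤ j → j + 1 ≤ T → Continuous (fun U => sfCut (θBal F.L γ b₀ p₀ (j + 1)) U * (Real.log (ρ (j + 1) U) - Real.log (ρ' (j + 1) U)) * ρ' (j + 1) U) ∧ Continuous (fun U => sfCut (θBal F.L γ b₀ p₀ (j + 1)) U * ρ' (j + 1) U) ∧ (∀ U, 0 ≤ sfCut (θBal F.L γ b₀ p₀ (j + 1)) U * ρ' (j + 1) U) ∧ (∀ U, PlaqSmall (24 / 25 * θBal F.L γ b₀ p₀ (j + 1)) U → 0 < sfCut (θBal F.L γ b₀ p₀ (j + 1)) U * ρ' (j + 1) 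U)

/-- stub · COAREA∘ (row 1, the content). -/
theorem stub_regularFibrePackage : RegularFibrePackageCan := by
  sorry

/-- stub · PINCH∘ (row 2, routine). -/
theorem stub_fibrePinch : FibrePinchCan := by
  sorry

/-- ★ JUNCTION (kernel-checked, no sorry): `m(V) := (∫ g₁ dλ_V)/(∫ g₂ dλ_V)`.  Window continuity = `ContinuousOn.div` with the
denominator positive by MASS (`integral_pos_iff_support_of_nonneg`: `g₂ ≥ 0`, `λ_V`-integrable, `> 0` on a set of positive
`λ_V`-measure); the a.e. identification = DISINT applied to `g₁`, `g₂` and `(φ⁻¹a)/(φ⁻¹b) = a/b` (`mul_div_mul_left`). -/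
theorem fibreMeanVersion_of_coarea
    (hC : RegularFibrePackageCan) (hP : FibrePinchCan) : FibreMeanVersionCan := by
  intro F γ b₀ p₀ hγ hγ1 hb₀ hp₀
  obtain ⟨jV, hC⟩ := hC F γ b₀ p₀ hγ hγ1 hb₀ hp₀
  refine ⟨jV, ?_⟩
  intro j₀ prm η ν hG hCν K K' hKK' Ts T hTs hTK μ μ' ρ ρ' hanch hcut hcons hfin hwin j hjV hj₀ hjT σ hσM hσb hσf
  obtain ⟨lam, hint, hcont, hmass, hdis⟩ := hC j hjV
  obtain ⟨hg1, hg2, hnn, hpos⟩ :=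
    hP F γ b₀ p₀ hγ hγ1 hb₀ hp₀ j₀ prm η ν hG hCν K K' hKK' Ts T hTs hTK μ μ' ρ ρ' hanch hcut hcons hfin hwin j hj₀ hjT
  obtain ⟨φ, hφ⟩ := hdis σ hσM hσb hσf
  have hv1 : ∀ U, sfCut (θBal F.L γ b₀ p₀ (j + 1)) U = 0 →
      sfCut (θBal F.L γ b₀ p₀ (j + 1)) U * (Real.log (ρ (j + 1) U) - Real.log (ρ' (j + 1) U)) * ρ' (j + 1) U = 0 := by
    intro U hU
    rw [hU, zero_mul, zero_mul]
  have hv2 : ∀ U, sfCut (θBal F.L γ b₀ p₀ (j + 1)) U = 0 → sfCut (θBal F.L γ b₀ p₀ (j + 1)) U * ρ' (j + 1) U = 0 := by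
    intro U hU
    rw [hU, zero_mul]
  have hden : ∀ V, PlaqSmall (θBal F.L γ b₀ p₀ j) V →
      0 < ∫ U, sfCut (θBal F.L γ b₀ p₀ (j + 1)) U * ρ' (j + 1) U ∂(lam V) := by
    intro V hV
    refine (integral_pos_iff_support_of_nonneg (fun U => hnn U) (hint V _ hg2)).mpr ?_
    exact lt_of_lt_of_le (hmass V hV) (measure_mono fun U hU => Function.mem_support.mpr (hpos U hU).ne')
  refine ⟨fun V => (∫ U, sfCut (θBal F.L γ b₀ p₀ (j + 1)) U * (Real.log (ρ (j + 1) U) - Real.log (ρ' (j + 1) U)) * ρ' (j + 1) U ∂(lam V)) /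
      (∫ U, sfCut (θBal F.L γ b₀ p₀ (j + 1)) U * ρ' (j + 1) U ∂(lam V)), ?_, ?_⟩
  · exact (hcont _ hg1 hv1).div (hcont _ hg2 hv2) fun V hV => (hden V hV).ne'
  · filter_upwards [hφ] with V hV hVw
    obtain ⟨hφpos, hφg⟩ := hV hVw
    obtain ⟨hi1, he1⟩ := hφg _ hg1 hv1
    obtain ⟨hi2, he2⟩ := hφg _ hg2 hv2
    refine ⟨hi1, ?_⟩
    show (∫ U, sfCut (θBal F.L γ b₀ p₀ (j + 1)) U * (Real.log (ρ (j + 1) U) - Real.log (ρ' (j + 1) U)) * ρ' (j + 1) U ∂(lam V)) /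
        (∫ U, sfCut (θBal F.L γ b₀ p₀ (j + 1)) U * ρ' (j + 1) U ∂(lam V)) = _
    rw [he1, he2, mul_div_mul_left _ _ (inv_ne_zero hφpos.ne')]

/-- plug: VER∘ from the two stubs (what `OrganTangent.stub_fibreMeanVersion` would be replaced by, text-identically). -/
theorem fibreMeanVersion_of_stubs : FibreMeanVersionCan :=
  fibreMeanVersion_of_coarea stub_regularFibrePackage stub_fibrePinch

end Summit.QuantumFields.YangMills.Cruxes.FluctuationComparisonRegPrIntL.VersionCoarea
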